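import Literature.Geometry.Kaehler.ManifoldForms
import Mathlib.Analysis.InnerProductSpace.PiL2
import Mathlib.Analysis.SpecialFunctions.Trigonometric.Deriv
import Mathlib.Geometry.Manifold.Instances.Real
import Mathlib.Geometry.Manifold.MFDeriv.Basic

/-!
# Helpers `helper_mfderiv_eq_of_eqOn_sphere`, `helper_trace_congr_of_eqOn_sphere` of line
`stable-seam-host` for crux `OrigamiFoldExistence` (item stmt-SmoothPoincare4-7844, route
route-SmoothPoincare4-SymplecticOrigami)

Bricks T / T2 (TANGENTIAL CONGRUENCE) for the shield `helper_stableSeamV2_of_smoothPoincare4`: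
the stability clauses of the line only evaluate the seam trace
`Ω (g u) ![mfderiv g u v, mfderiv g u w]` of a shell map `g : ℝ⁴ → X` at unit vectors `u` on
vectors `v, w ⊥ u` (tangent to the unit sphere `S³ ⊂ ℝ⁴`), so two shell maps `g₁, g₂` which
agree ON THE UNIT SPHERE ONLY and are differentiable at `u` have the same clauses there:

* `helper_mfderiv_eq_of_eqOn_sphere` — their differentials agree on tangential vectors `v ⊥ u`:
  for `v ≠ 0` the great circle `γ t = cos (‖v‖t) • u + sin (‖v‖t) • v/‖v‖` lies on the
  unit sphere, `γ 0 = u`, `γ' 0 = v`; in the extended chart `ψ` at the common value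
  `g₁ u = g₂ u` the maps `ψ ∘ gᵢ` are Fréchet differentiable at `u` with derivative
  `mfderiv gᵢ u` (the source is the model vector space), and `ψ ∘ g₁ ∘ γ = ψ ∘ g₂ ∘ γ`
  identically, so the chain rule and uniqueness of one-variable derivatives give
  `mfderiv g₁ u v = mfderiv g₂ u v`.
* `helper_trace_congr_of_eqOn_sphere` — therefore the `Ω`-traces agree on tangential pairs
  (bridge the values of `Ω` along the point equality `g₁ u = g₂ u`).

No definitions, no named facts, no `sorry`.  Folklore calculus on manifolds.
-/

noncomputable section

-- the prescribed namespace `Summit.<P>.<Sub>.…` duplicates `SmoothPoincare4` (P = Sub)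
set_option linter.dupNamespace false

open scoped Manifold ContDiff Topology RealInnerProductSpace

namespace Summit.SmoothPoincare4.SmoothPoincare4.Theorems.OrigamiFoldExistence.StableSeamHost

/-! ### Great circles -/

/-- Through a unit vector `u`, in every direction `v ⊥ u`, there is a curve on the unit sphere
with initial velocity `v`: the constant curve if `v = 0`, else the great circle
`t ↦ cos (‖v‖ t) • u + sin (‖v‖ t) • v / ‖v‖`. [folklore] -/
theorem exists_sphereCurve_of_inner_eq_zero {u v : EuclideanSpace ℝ (Fin 4)} (hu : ‖u‖ = 1)
    (hvu : ⟪v, u⟫ = 0) :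
    ∃ γ : ℝ → EuclideanSpace ℝ (Fin 4),
      (∀ t, ‖γ t‖ = 1) ∧ γ 0 = u ∧ HasDerivAt γ v 0 := by
  by_cases hv : v = 0
  · subst hv
    exact ⟨fun _ => u, fun _ => hu, rfl, hasDerivAt_const (0 : ℝ) u⟩
  · have hv' : ‖v‖ ≠ 0 := norm_ne_zero_iff.2 hv
    set e : EuclideanSpace ℝ (Fin 4) := ‖v‖⁻¹ • v with he_def
    have he : ‖e‖ = 1 := by
      rw [he_def, norm_smul, norm_inv, norm_norm, inv_mul_cancel₀ hv']
    have hue : ⟪u, e⟫ = 0 := by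
      rw [he_def, real_inner_smul_right, real_inner_comm, hvu, mul_zero]
    refine ⟨fun t => Real.cos (‖v‖ * t) • u + Real.sin (‖v‖ * t) • e, fun t => ?_,
      by simp, ?_⟩
    · have h2 : ‖Real.cos (‖v‖ * t) • u + Real.sin (‖v‖ * t) • e‖ ^ 2 = 1 := by
        rw [norm_add_sq_real, norm_smul, norm_smul, real_inner_smul_left, real_inner_smul_right,
          hue, hu, he, Real.norm_eq_abs, Real.norm_eq_abs, mul_one, mul_one, sq_abs, sq_abs,
          mul_zero, mul_zero, mul_zero, add_zero, Real.cos_sq_add_sin_sq]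
      exact (pow_eq_one_iff_of_nonneg (norm_nonneg _) two_ne_zero).1 h2
    · have hl : HasDerivAt (fun t : ℝ => ‖v‖ * t) ‖v‖ 0 := by
        simpa using (hasDerivAt_id (0 : ℝ)).const_mul ‖v‖
      refine ((hl.cos.smul_const u).add (hl.sin.smul_const e)).congr_deriv ?_
      simp [he_def, smul_smul, mul_inv_cancel₀ hv']

/-! ### Differentials in a chart at the value -/

/-- For a map `g : ℝ⁴ → X` from the model vector space which is `MDifferentiableAt u`, the chart
representative `extChartAt (g u) ∘ g` is Fréchet differentiable at `u` with derivative
`mfderiv g u` (the extended chart of the source is the identity and `range (𝓡 4) = univ`).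
[folklore] -/
theorem hasFDerivAt_extChartAt_comp_of_mdifferentiableAt {X : Type} [TopologicalSpace X]
    [ChartedSpace (EuclideanSpace ℝ (Fin 4)) X] {g : EuclideanSpace ℝ (Fin 4) → X}
    {u : EuclideanSpace ℝ (Fin 4)} (hg : MDifferentiableAt (𝓡 4) (𝓡 4) g u) :
    HasFDerivAt (extChartAt (𝓡 4) (g u) ∘ g) (mfderiv (𝓡 4) (𝓡 4) g u) u := by
  have h := hg.hasMFDerivAt.2
  simp only [writtenInExtChartAt, extChartAt_model_space_eq_id, PartialEquiv.refl_coe,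
    PartialEquiv.refl_symm, modelWithCornersSelf_coe, Set.range_id, Function.comp_id, id_eq,
    hasFDerivWithinAt_univ] at h
  exact h

/-! ### Brick T — tangential congruence of differentials -/

/-- **Tangential congruence of differentials.**  Two maps `ℝ⁴ → X` into an `ℝ⁴`-charted
manifold which agree on the unit sphere and are differentiable at a unit vector `u` have
differentials at `u` which agree on every `v ⊥ u`: differentiate `extChartAt (g₁ u) ∘ gᵢ` along a curve on the
sphere through `u` with velocity `v`, on which the two chart representatives coincide, and use
uniqueness of derivatives. [folklore] -/
theorem helper_mfderiv_eq_of_eqOn_sphere : ∀ (X : Type) [TopologicalSpace X] [ChartedSpace (EuclideanSpace ℝ (Fin 4)) X] [IsManifold (𝓡 4) ∞ X] (g₁ g₂ : EuclideanSpace ℝ (Fin 4) → X) (u : EuclideanSpace ℝ (Fin 4)), ‖u‖ = 1 → (∀ y : EuclideanSpace ℝ (Fin 4), ‖y‖ = 1 → g₁ y = g₂ y) → MDifferentiableAt (𝓡 4) (𝓡 4) g₁ u → MDifferentiableAt (𝓡 4) (𝓡 4) g₂ u → ∀ v : EuclideanSpace ℝ (Fin 4), ⟪v, u⟫ = 0 →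 (mfderiv (𝓡 4) (𝓡 4) g₁ u v : EuclideanSpace ℝ (Fin 4)) = mfderiv (𝓡 4) (𝓡 4) g₂ u v := by
  intro X _ _ _ g₁ g₂ u hu hg h₁ h₂ v hvu
  obtain ⟨γ, hγs, hγ0, hγd⟩ := exists_sphereCurve_of_inner_eq_zero hu hvu
  have hp : g₂ u = g₁ u := (hg u hu).symm
  -- both chart representatives, in the SAME chart at `g₁ u = g₂ u`
  have H₁ : HasFDerivAt (extChartAt (𝓡 4) (g₁ u) ∘ g₁) (mfderiv (𝓡 4) (𝓡 4) g₁ u) u :=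
    hasFDerivAt_extChartAt_comp_of_mdifferentiableAt h₁
  have H₂ :
      HasFDerivAt (extChartAt (𝓡 4) (g₁ u) ∘ g₂) (mfderiv (𝓡 4) (𝓡 4) g₂ u) u := by
    have h := hasFDerivAt_extChartAt_comp_of_mdifferentiableAt h₂
    rw [hp] at h
    exact h
  -- along the curve the two representatives coincide
  have hcomp :
      (extChartAt (𝓡 4) (g₁ u) ∘ g₁) ∘ γ = (extChartAt (𝓡 4) (g₁ u) ∘ g₂) ∘ γ := by
    funext t
    simp only [Function.comp_apply, hg (γ t) (hγs t)]
  have D₁ := H₁.comp_hasDerivAt_of_eq 0 hγd hγ0.symm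
  have D₂ := H₂.comp_hasDerivAt_of_eq 0 hγd hγ0.symm
  rw [hcomp] at D₁
  exact D₁.unique D₂

/-! ### Brick T2 — tangential congruence of the seam trace -/

/-- **Tangential congruence of the seam trace.**  For a 2-form `Ω` on an `ℝ⁴`-charted
manifold `X` and two maps `ℝ⁴ → X` which agree on the unit sphere and are differentiable at a unit vector
`u`, the traces `Ω (gᵢ u) ![mfderiv gᵢ u v, mfderiv gᵢ u w]` agree on tangential pairs
`v, w ⊥ u` (brick T and transport of `Ω` along `g₁ u = g₂ u`). [folklore] -/
theorem helper_trace_congr_of_eqOn_sphere : ∀ (X : Type) [TopologicalSpace X] [ChartedSpace (EuclideanSpace ℝ (Fin 4)) X] [IsManifold (𝓡 4) ∞ X] (Ω : Literature.Geometry.Kaehler.MForm (𝓡 4) X ℝ 2) (g₁ g₂ : EuclideanSpace ℝ (Fin 4) → X) (u : EuclideanSpace ℝ (Fin 4)), ‖u‖ = 1 → (∀ y : EuclideanSpace ℝ (Fin 4), ‖y‖ = 1 → g₁ y = g₂ y) → MDifferentiableAt (𝓡 4) (𝓡 4) g₁ u → MDifferentiableAt (𝓡 4) (𝓡 4) g₂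 u → ∀ v w : EuclideanSpace ℝ (Fin 4), ⟪v, u⟫ = 0 → ⟪w, u⟫ = 0 → Ω (g₁ u) ![mfderiv (𝓡 4) (𝓡 4) g₁ u v, mfderiv (𝓡 4) (𝓡 4) g₁ u w] = Ω (g₂ u) ![mfderiv (𝓡 4) (𝓡 4) g₂ u v, mfderiv (𝓡 4) (𝓡 4) g₂ u w] := by
  intro X _ _ _ Ω g₁ g₂ u hu hg h₁ h₂ v w hvu hwu
  have hbridge : ∀ (p q : X), p = q → ∀ a b : EuclideanSpace ℝ (Fin 4),
      Ω p ![a, b] = Ω q ![a, b] := by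
    intro p q hpq a b; subst hpq; rfl
  have e1 : (mfderiv (𝓡 4) (𝓡 4) g₁ u v : EuclideanSpace ℝ (Fin 4)) =
      mfderiv (𝓡 4) (𝓡 4) g₂ u v :=
    helper_mfderiv_eq_of_eqOn_sphere X g₁ g₂ u hu hg h₁ h₂ v hvu
  have e2 : (mfderiv (𝓡 4) (𝓡 4) g₁ u w : EuclideanSpace ℝ (Fin 4)) =
      mfderiv (𝓡 4) (𝓡 4) g₂ u w :=
    helper_mfderiv_eq_of_eqOn_sphere X g₁ g₂ u hu hg h₁ h₂ w hwu
  calc Ω (g₁ u) ![mfderiv (𝓡 4) (𝓡 4) g₁ u v, mfderiv (𝓡 4) (𝓡 4) g₁ u w]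
      = Ω (g₁ u) ![(mfderiv (𝓡 4) (𝓡 4) g₂ u v : EuclideanSpace ℝ (Fin 4)),
          (mfderiv (𝓡 4) (𝓡 4) g₂ u w : EuclideanSpace ℝ (Fin 4))] := by rw [← e1, ← e2]
    _ = Ω (g₂ u) ![mfderiv (𝓡 4) (𝓡 4) g₂ u v, mfderiv (𝓡 4) (𝓡 4) g₂ u w] :=
          hbridge _ _ (hg u hu) _ _

end Summit.SmoothPoincare4.SmoothPoincare4.Theorems.OrigamiFoldExistence.StableSeamHost

end
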